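import Summits.MatrixMultiplication.OmegaCensus.DominoZ19StructSixArrB1
import Summits.MatrixMultiplication.OmegaCensus.DominoZ19StructSixArrB2
import Summits.MatrixMultiplication.OmegaCensus.DominoZ19StructSixArrB3
import Summits.MatrixMultiplication.OmegaCensus.DominoZ19StructSixArrB4
import Summits.MatrixMultiplication.OmegaCensus.DominoZ19StructSixArrB5
import Summits.MatrixMultiplication.OmegaCensus.DominoZ19StructSixArrB6
import HarnessLib

/-!
# The `y`-arrangement list of family `B` for the structural part-`6` route, `p = 19`: assembly

ω-census `pub-omega`, family (b3), seat pub-omega-group gen 25.  Framing: lottery ticket; floor = certified bounds/negative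
ranges.  VALUE: per-prime kernel data of the structural part-`6` route WITHOUT the pigeonhole (`DominoZpZpStructSixWide*.lean`)
for `p = 19` — target: the OPEN census cell `(1,6,20)@361` (`A = ℤ₁₉²`) and every larger order with such a quotient; NOT progress on ω.

`hysbZ19s6` (hypothesis `hYSb` of `exists_entry_structSixWide_of_checks`) from the per-representative decides.
-/

namespace Summit.MatrixMultiplication.OmegaCensus

open ZpZpDomino

namespace ZpZpDomino

/-- **Completeness of `ysbZ19s6`**: every `arr6Y2`-arrangement of every representative is listed. [folklore] -/
theorem hysbZ19s6 : ∀ k ∈ rZ19s6, ∀ ys ∈ arr6Y2 19 k, ys ∈ ysbZ19s6 := by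
  have h : ∀ k ∈ rZ19s6, ((arr6Y2 19 k).all fun ys => ysbZ19s6.contains ys) = true := by
    simp only [rZ19s6, List.forall_mem_cons]
    exact ⟨ysbZ19s6_c0, ysbZ19s6_c1, ysbZ19s6_c2, ysbZ19s6_c3, ysbZ19s6_c4, ysbZ19s6_c5, ysbZ19s6_c6, ysbZ19s6_c7, ysbZ19s6_c8, ysbZ19s6_c9, ysbZ19s6_c10, ysbZ19s6_c11, ysbZ19s6_c12, ysbZ19s6_c13, ysbZ19s6_c14, ysbZ19s6_c15, ysbZ19s6_c16, ysbZ19s6_c17, ysbZ19s6_c18, ysbZ19s6_c19, ysbZ19s6_c20, ysbZ19s6_c21, ysbZ19s6_c22, ysbZ19s6_c23, ysbZ19s6_c24, ysbZ19s6_c25, ysbZ19s6_c26, ysbZ19s6_c27, ysbZ19s6_c28, ysbZ19s6_c29, ysbZ19s6_c30, ysbZ19s6_c31, ysbZ19s6_c32, ysbZ19s6_c33, ysbZ19s6_c34, ysbZ19s6_c35, ysbZ19s6_c36, ysbZ19s6_c37, ysbZ19s6_c38, ysbZ19s6_c39, ysbZ19s6_c40, ysbZ19s6_c41, ysbZ19s6_c42,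 ysbZ19s6_c43, ysbZ19s6_c44, ysbZ19s6_c45, ysbZ19s6_c46, ysbZ19s6_c47, ysbZ19s6_c48, ysbZ19s6_c49, ysbZ19s6_c50, ysbZ19s6_c51, ysbZ19s6_c52, ysbZ19s6_c53, ysbZ19s6_c54, ysbZ19s6_c55, ysbZ19s6_c56, ysbZ19s6_c57, ysbZ19s6_c58, ysbZ19s6_c59, ysbZ19s6_c60, ysbZ19s6_c61, ysbZ19s6_c62, ysbZ19s6_c63, fun _ h => (List.not_mem_nil h).elim⟩
  intro k hk ys hys
  have := List.all_eq_true.1 (h k hk) ys hys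
  rwa [List.contains_iff_mem] at this

end ZpZpDomino

end Summit.MatrixMultiplication.OmegaCensus
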